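import Literature.NumberTheory.EllipticCurves.Kato2004.ZetaBodyLayerValuesTwoProofs
import Literature.NumberTheory.EllipticCurves.Kato2004.IwasawaH1LayerEigenfunctionalProofs
import Mathlib.FieldTheory.IsAlgClosed.Basic
import Literature.NumberTheory.EllipticCurves.PAdicLFunctionIntegralityAtTwoProofs
import Mathlib.Algebra.Module.Torsion.Field
import HarnessLib

/-!
# Kato 2004, Thm. 12.5 (1) for `z(f_W)` at `p = 2` in the finite-level eigenfunctional currency: for the pinned
# Λ-adic lift `y ∈ 𝐇¹_Γ(T₂W)` of Kato's zeta family, EVERY primitive even character `χ` of `2`-power conductor off a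
# FINITE set carries a `χ(γ₀)`-eigenfunctional `w` on a layer `H¹(ℚ_n, T₂W)` with `w(proj_n y) ≠ 0` — the
# hypothesis `hw` (Kato side) of `IwasawaH1Data.lengthAt_quotient_span_eq_of_layerFunctionals` as a THEOREM modulo
# a `ZetaBody` witness and Rohrlich (THEOREMS ONLY)

Topic `NumberTheory/EllipticCurves`, sub-directory `Kato2004` (namespace = path). THEOREMS ONLY (net debt 0).
Cell `bsd-2adic`, seat `bsd-2adic-addL2x` (GEN 20; crux stmt-BirchSwinnertonDyer-19098 `AdditiveRankZeroAtTwo`,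
child C4″ stmt-BirchSwinnertonDyer-22618; road R-B83 (2): the residual READING (i) of step T22 (b) of the descent
sockets `AddKatoTwo.KatoDescentSocketAtTwoAdditive…` for the Kato class `z(f_W)` becomes a theorem). HONEST FRAMING:
BSD is not proved by any of this; nothing about Kato's Main Conjecture is asserted; the statements are CONDITIONAL on
a `ZetaBody` witness over Kato's guarded datum (the construction facts `exists_eulerSystem_expStar_values` /
`exists_member_eulerSystem_expStar_values` produce one) and take Rohrlich's finiteness for `f` at `2` as the displayed
hypothesis `hR` in the exact shape of the kernel theorem `PSRohrlichAtLevel.rohrlich_primePow_of_isNewformOf`.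

## The statement (`exists_finset_forall_layerEigenfunctional_lift_ne_zero_two`)

Data: `W/ℚ` elliptic (structure facts of `T₂W` as instance binders), `f` its newform, a
`ZetaBody W 2 f ι κ Λ c d a A z x` witness with `κ ≠ 0` over Kato's datum (`(c, 12A) = (d, 12N) = 1`,
`c ≡ d ≡ 1 (mod A)`, `c, d > 1`, `[a/A]⁻_f ≠ 0`; `exists_katoDatum`), `K` the cyclotomic `ℤ₂`-extension with a
topological generator `γ` (`K γ = 1`), a pin `I : IwasawaH1Data W 2 K γ` and `y ∈ 𝐇¹_Γ(T₂W)` with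
`proj_n y = Cor_{ℚ(μ_{2^{n+2}})/ℚ_n}(z_{n+2,∅})` for all `n` (`IwasawaH1Data.existsUnique_lift_of_zetaBody_two`).
Conclusion: there is a finite `S ⊂ ℂ₂` such that for every `m > 0` and every PRIMITIVE EVEN Dirichlet character
`χ` mod `2^m` with values in `ℂ₂` and `χ(γ₀) − 1 ∉ S` (`γ₀ = 5 = cyclotomicGenerator 2`), at the layer `n = m − 2`
there is an additive `w : H¹(ℚ_n, T₂W) → ℂ₂`, `ℤ₂`-semilinear, a `χ(γ₀)`-EIGENFUNCTIONAL for `conj_γ`, with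
`χ(γ₀)^{2^n} = 1` and `w(proj_n y) ≠ 0` — verbatim the Kato-side conjuncts of the hypothesis `hw` of
`IwasawaH1Data.lengthAt_quotient_span_eq_of_layerFunctionals` (p741570; the remaining conjunct there concerns the
SECOND class `z̃` and its period ratio, not this file).

## The argument (tree theorems only)

`M = 2^{n+2}`, `g = 5`, `u = χ_cyc(γ) mod M`. Every unit is `±u^t` (`exists_eq_pow_or_eq_neg_pow_of_isTopGenerator_two`)
and `±g^s` (`exists_eq_five_pow_or_eq_neg_five_pow`); `χ(g) = χ(u)^t`. Put `ψ := (χ^t)⁻¹`: an even character mod `M`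
with `ψ(u)⁻¹ = χ(g) = χ(γ₀)`, PRIMITIVE (it is a power of `χ` and `χ` is a power of it — even characters are
determined by their value at `u`). The functional is `w := Σ_b ψ(b)·J((1⊗σ_b)Λ_{n+2,∅}(res ·))`
(`exists_layerEigenfunctional` with (C3a)): eigenvalue `ψ(u)⁻¹ = χ(γ₀)`, and value
`w(proj_n y) = 2·Σ_b ψ(b) ι₂(σ_b x_{n+2,∅})` ((C4), `ψ` kills `χ_cyc(Gal(ℚ̄/ℚ_n)) = {±1}`). LIFT `ψ = ψ_F ∘ ι₂` to
`F = ℚ(ζ_M)` (`exists_ringHomComp_eq`): the sum is `ι₂(S_F)`, `S_F = Σ_b ψ_F(b)σ_b x`, and the witness's complex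
embedding gives `ι_M(S_F) = Σ_b ψ_ℂ(b) ι_M(σ_b x) = κ·L(1)/Ω⁺_f·R⁻_{ψ_ℂ⁻¹}` by the VALUE LAW (C5) for the even primitive
complex character `ψ_ℂ = ψ_F ∘ ι_M` and any entire continuation `L` of the `(2A·M)`-depleted twisted series; off
Rohrlich's finite set (conductor `M = 2^m > B`) `L(1) ≠ 0` (Shimura + `exists_continuation_changeLevel_of`),
`R⁻_{ψ_ℂ⁻¹} ≠ 0` for Kato's datum (`cuspFactor_true_ne_zero_of_katoDatum`), `κ ≠ 0`, `Ω⁺_f > 0`: so `S_F ≠ 0` and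
`w(proj_n y) ≠ 0`. The finite set is `S = {ζ − 1 : ζ^{2^B} = 1}` (`B ≥ 2` bounding Rohrlich's levels): a character
of conductor `2^m ≤ B` has `χ(γ₀)^{2^B} = 1`.

References: K. Kato, Astérisque 295 (2004), Thm. 12.5 (1) and its proof pp. 221–222, Thm. 9.7 p. 189, Thm. 6.6 (1)
p. 163, §13.8 p. 228, 13.5 (2) p. 227 [Kato2004Asterisque]; D. E. Rohrlich, Invent. Math. 75 (1984) / 97 (1989)
[RohrlichInventiones1984]; B. Mazur, J. Tate, J. Teitelbaum, Invent. Math. 84 (1986) §I.13 [MazurTateTeitelbaum1986Invent];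
L. C. Washington, *Introduction to Cyclotomic Fields* §13.1 [Washington1997].
-/

set_option autoImplicit false

noncomputable section

open scoped BigOperators NumberField TensorProduct MatrixGroups
open Field IsDedekindDomain CongruenceSubgroup
open Literature.NumberTheory.GaloisRepresentations
open Literature.NumberTheory.EllipticCurves Literature.NumberTheory.EllipticCurves.ModularForms
open Literature.NumberTheory.EllipticCurves.Kato2004.EulerSystemValues Rat.HeightOneSpectrum

namespace Literature.NumberTheory.EllipticCurves.Kato2004

/-! ## §1 Small character lemmas -/

section Characters

variable {R : Type*} [CommRing R] {M : ℕ}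

/-- **Even characters are determined by their value at a generator of `(ℤ/M)ˣ/{±1}`**: if every unit is `±u^s`
and two EVEN characters agree at `u`, they are equal (the `u`-version of
`LayerCharacterTwo.eq_of_even_of_apply_five_eq`). [cite: Washington1997, §13.1] -/
theorem eq_of_even_of_apply_eq_of_forall_eq_pow_or {u : (ZMod M)ˣ}
    (hgen : ∀ b : (ZMod M)ˣ, ∃ s : ℕ, b = u ^ s ∨ b = -(u ^ s)) {χ ψ : DirichletCharacter R M}
    (hχ : χ.Even) (hψ : ψ.Even) (h : χ u = ψ u) : χ = ψ := by
  refine MulChar.ext fun b ↦ ?_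
  obtain ⟨s, hb⟩ := hgen b
  have hpow : χ ((u ^ s : (ZMod M)ˣ) : ZMod M) = ψ ((u ^ s : (ZMod M)ˣ) : ZMod M) := by
    rw [Units.val_pow_eq_pow_val, map_pow, map_pow, h]
  rcases hb with rfl | rfl
  · exact hpow
  · rw [Units.val_neg, hχ.eval_neg, hψ.eval_neg, hpow]

/-- The inverse of an even character is even (values in a field). [cite: Washington1997, Ch. 3] -/
theorem even_inv {K : Type*} [Field K] {N : ℕ} {χ : DirichletCharacter K N} (hχ : χ.Even) : χ⁻¹.Even := by
  change χ⁻¹ (-1) = 1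
  rw [MulChar.inv_apply_eq_inv', hχ, inv_one]

end Characters

/-! ## §2 The assembly at `p = 2` -/

section Assembly

variable {W : WeierstrassCurve ℚ} [W.IsElliptic] [ContinuousSMul ℤ_[2] (W.tateModule 2)]
  [Module.Free ℤ_[2] (W.tateModule 2)] [Module.Finite ℤ_[2] (W.tateModule 2)] {N : ℕ} [NeZero N]
  {f : CuspForm (Gamma0 N) 2} {ι : (m : ℕ) → (CyclotomicField m ℚ →+* ℂ)} {κ' : ℝ}
  {Λ' : ∀ (k : ℕ) (r : Finset (HeightOneSpectrum (𝓞 ℚ))),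
    H1 (tateRep W 2) (cycSubgroup 2 k r) →ₗ[ℤ_[2]] ℚ_[2] ⊗[ℚ] CyclotomicField (cycLevel 2 k r) ℚ}
  {c d a : ℤ} {A : ℕ}
  {z : ∀ (k : ℕ) (r : (cyclotomicLevelsRat 2 (badPlaces c d A N)).Ideals),
    H1 (tateRep W 2) ((cyclotomicLevelsRat 2 (badPlaces c d A N)).level k r.1)}
  {x : ∀ (k : ℕ) (r : (cyclotomicLevelsRat 2 (badPlaces c d A N)).Ideals),
    CyclotomicField (cycLevel 2 k r.1) ℚ}
  {K : ZpExtension ℚ 2} {γ : absoluteGaloisGroup ℚ} {I : IwasawaH1Data W 2 K γ}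

set_option backward.isDefEq.respectTransparency false in
/-- **The non-vanishing of ONE layer value**: for a `ZetaBody` witness over Kato's datum at `p = 2` and an EVEN
PRIMITIVE `ℂ₂`-valued character `ψ` mod `M = 2^{n+2}` whose conductor exceeds Rohrlich's bound (every primitive `χ`
of `2`-power conductor `> B` has an entire continuation of `L(f,χ,s)` non-vanishing at `1`), and any `2`-adic
embedding `ι₂ : ℚ(ζ_M) → ℂ₂`: `Σ_b ψ(b) ι₂(σ_b x_{n+2,∅}) ≠ 0`. Mechanism: lift `ψ = ψ_F ∘ ι₂` to `F = ℚ(ζ_M)`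
(`LayerCharacterTwo.exists_ringHomComp_eq`); `ι_M(Σ_b ψ_F(b)σ_b x) = κ·L(1)/Ω⁺·R⁻_{ψ_ℂ⁻¹}` by the value law (C5) for
`ψ_ℂ = ψ_F ∘ ι_M` (even, primitive: `even_ringHomComp_iff`, `isPrimitive_ringHomComp_iff`); `L(1) ≠ 0` (Shimura +
Rohrlich + `exists_continuation_changeLevel_of`), `R⁻ ≠ 0` (`cuspFactor_true_ne_zero_of_katoDatum`).
[cite: Kato2004Asterisque, Thm. 12.5 (1) (pp. 221–222), Thm. 9.7 (p. 189), Thm. 6.6 (1) (p. 163)] -/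
theorem sum_character_embed_sigma_ne_zero_of_rohrlich_two (hbody : ZetaBody W 2 f ι κ' Λ' c d a A z x)
    (hf : IsNewformOf W f) (hκ' : κ' ≠ 0) (hA : 0 < A) (hc : Int.gcd c (6 * 2 * A) = 1)
    (hd : Int.gcd d (6 * 2 * N) = 1) (hcA : (A : ℤ) ∣ c - 1) (hdA : (A : ℤ) ∣ d - 1) (hc1 : 1 < c)
    (hd1 : 1 < d) (ha : ratMinusSymbol f ((a : ℚ) / A) ≠ 0) {B : ℕ}
    (hB : ∀ χ : (Σ m : ℕ, DirichletCharacter ℂ m), χ ∈ {χ : Σ m : ℕ, DirichletCharacter ℂ m |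
        χ.1 ≠ 0 ∧ χ.1.primeFactors ⊆ {2} ∧ χ.2.IsPrimitive ∧
          ∃ L : ℂ → ℂ, Differentiable ℂ L ∧
            (∀ s : ℂ, 2 < s.re → L s = twistedLSeries f χ.2 s) ∧ L 1 = 0} → χ.1 ≤ B)
    (n : ℕ) (hBn : B < 2 ^ (n + 2)) (ι₂ : CyclotomicField (cycLevel 2 (n + 2) ∅) ℚ →+* ℂ_[2])
    (ψ : DirichletCharacter ℂ_[2] (cycLevel 2 (n + 2) ∅)) (hψe : ψ.Even) (hψp : ψ.IsPrimitive) :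
    ∑ b : (ZMod (cycLevel 2 (n + 2) ∅))ˣ, ψ (b : ZMod (cycLevel 2 (n + 2) ∅)) *
      ι₂ (sigma (cycLevel 2 (n + 2) ∅) b (x (n + 2) (cyclotomicLevelsRat 2 (badPlaces c d A N)).idealOne)) ≠ 0 := by
  have hM : cycLevel 2 (n + 2) ∅ = 2 ^ (n + 2) := by simp [cycLevel]
  have hdd' : d * 1 ≡ 1 [ZMOD (A : ℤ)] := by
    rw [mul_one, Int.modEq_iff_dvd]
    obtain ⟨k, hk⟩ := hdA
    exact ⟨-k, by linear_combination -hk⟩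
  -- lift `ψ` to `F = ℚ(ζ_M)`
  have hcard : Fintype.card (ZMod (cycLevel 2 (n + 2) ∅))ˣ ∣ cycLevel 2 (n + 2) ∅ := by
    rw [ZMod.card_units_eq_totient, hM, Nat.totient_prime_pow Nat.prime_two (by omega),
      show n + 2 - 1 = n + 1 from rfl]
    exact ⟨2, by ring⟩
  have he : ∀ b : (ZMod (cycLevel 2 (n + 2) ∅))ˣ, b ^ cycLevel 2 (n + 2) ∅ = 1 := fun b ↦
    orderOf_dvd_iff_pow_eq_one.mp (dvd_trans (orderOf_dvd_card) hcard)
  obtain ⟨ψF, hψF⟩ := LayerCharacterTwo.exists_ringHomComp_eq (N := cycLevel 2 (n + 2) ∅) ι₂.injective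
    (IsCyclotomicExtension.zeta_spec (cycLevel 2 (n + 2) ∅) ℚ (CyclotomicField (cycLevel 2 (n + 2) ∅) ℚ)) he ψ
  -- the complex character `ψ_ℂ = ψ_F ∘ ι_M`: even and primitive
  set ψC : DirichletCharacter ℂ (cycLevel 2 (n + 2) ∅) := ψF.ringHomComp (ι (cycLevel 2 (n + 2) ∅)) with hψC
  have hψFe : ψF.Even := by
    rw [← LayerCharacterTwo.even_ringHomComp_iff ψF ι₂.injective, hψF]; exact hψe
  have hψFp : ψF.IsPrimitive := by
    rw [← LayerCharacterTwo.isPrimitive_ringHomComp_iff ψF ι₂.injective, hψF]; exact hψp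
  have hψCe : ψC.Even :=
    (LayerCharacterTwo.even_ringHomComp_iff ψF (ι (cycLevel 2 (n + 2) ∅)).injective).mpr hψFe
  have hψCp : ψC.IsPrimitive :=
    (LayerCharacterTwo.isPrimitive_ringHomComp_iff ψF (ι (cycLevel 2 (n + 2) ∅)).injective).mpr hψFp
  have heven : ψC (-1) = 1 := hψCe
  -- Shimura: an entire continuation `L₀` of `L(f, ψ_ℂ, s)`; Rohrlich: `L₀ 1 ≠ 0` (conductor `2^{n+2} > B`)
  obtain ⟨L₀, hL₀d, hL₀s⟩ := exists_differentiable_eq_twistedLSeries_holds f (m := cycLevel 2 (n + 2) ∅) ψC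
  have hL₀1 : L₀ 1 ≠ 0 := by
    intro h0
    have hle : cycLevel 2 (n + 2) ∅ ≤ B := by
      refine hB ⟨cycLevel 2 (n + 2) ∅, ψC⟩ ⟨NeZero.ne _, ?_, hψCp, L₀, hL₀d, hL₀s, h0⟩
      change (cycLevel 2 (n + 2) ∅).primeFactors ⊆ {2}
      rw [hM, Nat.primeFactors_prime_pow (Nat.succ_ne_zero _) Nat.prime_two]
    rw [hM] at hle
    exact absurd hle (not_le.mpr hBn)
  haveI : NeZero (cycLevel 2 (n + 2) ∅ * (2 * A)) :=
    ⟨mul_ne_zero (NeZero.ne _) (mul_ne_zero two_ne_zero hA.ne')⟩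
  obtain ⟨L, hLd, hLs, hL1⟩ := exists_continuation_changeLevel_of hf
    (dvd_mul_right (cycLevel 2 (n + 2) ∅) (2 * A)) ψC ⟨L₀, hL₀d, hL₀s, hL₀1⟩
  have hdep : IsDepletedTwistedL f (cycLevel 2 (n + 2) ∅) (2 * A) ψC L := ⟨hLd, hLs⟩
  -- the value law (C5), even clause
  have h5 := ((hbody.2.2.2.2.2) (n + 2) (cyclotomicLevelsRat 2 (badPlaces c d A N)).idealOne 1 ψC L
    (gcd_mul_cycLevel_mul_eq_one_of_guards hc hd hdd' (n + 1)) hdd' hdep).1 heven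
  -- `R⁻_{ψ_ℂ⁻¹} ≠ 0`, `κ ≠ 0`, `Ω⁺ ≠ 0`, `L 1 ≠ 0`: the character sum is non-zero
  have hcusp : cuspFactor f true (fun k ↦ ψC⁻¹ (k : ZMod (cycLevel 2 (n + 2) ∅))) c d a A 1 ≠ 0 :=
    cuspFactor_true_ne_zero_of_katoDatum f ψC⁻¹ hA hcA hc1 hd1
      (isUnit_intCast_zmod_of_gcd_eq_one hc n hM) (isUnit_intCast_zmod_of_gcd_eq_one hd n hM) ha
  have hΩ : (plusPeriod f : ℂ) ≠ 0 := by
    exact_mod_cast (IsNewform0.plusPeriod_pos_holds hf.1 hf.coeffField_eq_bot).ne'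
  have hκ : (κ' : ℂ) ≠ 0 := by exact_mod_cast hκ'
  have hcs : charSum (cycLevel 2 (n + 2) ∅) (ι (cycLevel 2 (n + 2) ∅)) ψC
      (x (n + 2) (cyclotomicLevelsRat 2 (badPlaces c d A N)).idealOne) ≠ 0 := by
    change charSum (cycLevel 2 (n + 2) (cyclotomicLevelsRat 2 (badPlaces c d A N)).idealOne.1)
      (ι (cycLevel 2 (n + 2) (cyclotomicLevelsRat 2 (badPlaces c d A N)).idealOne.1)) ψC
      (x (n + 2) (cyclotomicLevelsRat 2 (badPlaces c d A N)).idealOne) ≠ 0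
    rw [h5]
    exact mul_ne_zero (mul_ne_zero hκ (div_ne_zero hL1 hΩ)) hcusp
  -- `charSum = ι_M(S_F)` and the `2`-adic sum is `ι₂(S_F)`
  have hC : charSum (cycLevel 2 (n + 2) ∅) (ι (cycLevel 2 (n + 2) ∅)) ψC
      (x (n + 2) (cyclotomicLevelsRat 2 (badPlaces c d A N)).idealOne) =
      ι (cycLevel 2 (n + 2) ∅) (∑ b : (ZMod (cycLevel 2 (n + 2) ∅))ˣ, ψF (b : ZMod (cycLevel 2 (n + 2) ∅)) *
        sigma (cycLevel 2 (n + 2) ∅) b (x (n + 2) (cyclotomicLevelsRat 2 (badPlaces c d A N)).idealOne)) := by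
    unfold charSum
    rw [map_sum]
    refine Finset.sum_congr rfl fun b _ ↦ ?_
    rw [map_mul, hψC, MulChar.ringHomComp_apply]
  have hSF : ∑ b : (ZMod (cycLevel 2 (n + 2) ∅))ˣ, ψF (b : ZMod (cycLevel 2 (n + 2) ∅)) *
      sigma (cycLevel 2 (n + 2) ∅) b (x (n + 2) (cyclotomicLevelsRat 2 (badPlaces c d A N)).idealOne) ≠ 0 := by
    intro h0
    rw [hC, h0, map_zero] at hcs
    exact hcs rfl
  have h2 : ∑ b : (ZMod (cycLevel 2 (n + 2) ∅))ˣ, ψ (b : ZMod (cycLevel 2 (n + 2) ∅)) *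
      ι₂ (sigma (cycLevel 2 (n + 2) ∅) b (x (n + 2) (cyclotomicLevelsRat 2 (badPlaces c d A N)).idealOne)) =
      ι₂ (∑ b : (ZMod (cycLevel 2 (n + 2) ∅))ˣ, ψF (b : ZMod (cycLevel 2 (n + 2) ∅)) *
        sigma (cycLevel 2 (n + 2) ∅) b (x (n + 2) (cyclotomicLevelsRat 2 (badPlaces c d A N)).idealOne)) := by
    rw [map_sum]
    refine Finset.sum_congr rfl fun b _ ↦ ?_
    rw [map_mul, ← hψF, MulChar.ringHomComp_apply]
  rw [h2, map_ne_zero_iff _ ι₂.injective]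
  exact hSF

/-- **Kato Thm. 12.5 (1) for `z(f_W)` at `p = 2`, finite-level eigenfunctional form** (the Kato-side hypothesis
`hw` of `IwasawaH1Data.lengthAt_quotient_span_eq_of_layerFunctionals` as a theorem). For a `ZetaBody` witness over
Kato's guarded datum at `p = 2` (`f` the newform of `W`, `κ ≠ 0`), `K` cyclotomic with topological generator `γ`, a
pin `I` and `y ∈ 𝐇¹_Γ(T₂W)` with `proj_n y = Cor_{ℚ(μ_{2^{n+2}})/ℚ_n}(z_{n+2,∅})`, GRANTED Rohrlich's finiteness for
`f` at `2` (`hR`): there is a finite `S ⊂ ℂ₂` such that every primitive even `ℂ₂`-valued Dirichlet character `χ`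
mod `2^m` (`m > 0`) with `χ(γ₀) − 1 ∉ S` admits a layer `n` and an additive `w : H¹(ℚ_n, T₂W) → ℂ₂` which is
`ℤ₂`-semilinear, a `χ(γ₀)`-eigenfunctional for `conj_γ` (`γ₀ = cyclotomicGenerator 2 = 5`), with
`χ(γ₀)^{2^n} = 1` and `w(proj_n y) ≠ 0`. [cite: Kato2004Asterisque, Thm. 12.5 (1) (pp. 221–222), §13.8 (p. 228), 13.5 (2) (p. 227)]
[cite: MazurTateTeitelbaum1986Invent, §I.13] -/
theorem exists_finset_forall_layerEigenfunctional_lift_ne_zero_two (hbody : ZetaBody W 2 f ι κ' Λ' c d a A z x)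
    (hf : IsNewformOf W f) (hκ' : κ' ≠ 0) (hA : 0 < A) (hc : Int.gcd c (6 * 2 * A) = 1)
    (hd : Int.gcd d (6 * 2 * N) = 1) (hcA : (A : ℤ) ∣ c - 1) (hdA : (A : ℤ) ∣ d - 1) (hc1 : 1 < c)
    (hd1 : 1 < d) (ha : ratMinusSymbol f ((a : ℚ) / A) ≠ 0) (hK : K.IsCyclotomic) (hγ : K.IsTopGenerator γ)
    {y : I.H}
    (hy : ∀ n : ℕ, I.proj n y = levelToLayerTwo W hK (badPlaces c d A N) n
      (z (n + 2) (cyclotomicLevelsRat 2 (badPlaces c d A N)).idealOne))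
    (hR : Set.Finite {χ : Σ m : ℕ, DirichletCharacter ℂ m |
        χ.1 ≠ 0 ∧ χ.1.primeFactors ⊆ {2} ∧ χ.2.IsPrimitive ∧
          ∃ L : ℂ → ℂ, Differentiable ℂ L ∧
            (∀ s : ℂ, 2 < s.re → L s = twistedLSeries f χ.2 s) ∧ L 1 = 0}) :
    ∃ S : Finset ℂ_[2], ∀ m : ℕ, 0 < m → ∀ χ : DirichletCharacter ℂ_[2] (2 ^ m), χ.IsPrimitive → χ.Even →
      (χ (cyclotomicGenerator 2 : ZMod (2 ^ m)) - 1) ∉ S →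
      ∃ (n : ℕ) (w : H1 (tateRep W 2) (K.layerSubgroup n) →+ ℂ_[2]),
        χ (cyclotomicGenerator 2 : ZMod (2 ^ m)) ^ 2 ^ n = 1 ∧
        (∀ (e : ℤ_[2]) (v : H1 (tateRep W 2) (K.layerSubgroup n)),
          w (e • v) = ((algebraMap ℚ_[2] ℂ_[2]).comp (algebraMap ℤ_[2] ℚ_[2])) e * w v) ∧
        (∀ v : H1 (tateRep W 2) (K.layerSubgroup n),
          w ((conjMap (tateRep W 2).toTopRep (K.layerSubgroup n) γ 1).hom.toLinearMap v) =
            χ (cyclotomicGenerator 2 : ZMod (2 ^ m)) * w v) ∧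
        w (I.proj n y) ≠ 0 := by
  classical
  -- Rohrlich's exceptional levels are bounded by some `B₀`; take `B ≥ 2`
  obtain ⟨B₀, hB₀⟩ := (hR.image Sigma.fst).bddAbove
  set B : ℕ := max B₀ 2 with hBdef
  have hB : ∀ χ : (Σ m : ℕ, DirichletCharacter ℂ m), χ ∈ {χ : Σ m : ℕ, DirichletCharacter ℂ m |
      χ.1 ≠ 0 ∧ χ.1.primeFactors ⊆ {2} ∧ χ.2.IsPrimitive ∧
        ∃ L : ℂ → ℂ, Differentiable ℂ L ∧
          (∀ s : ℂ, 2 < s.re → L s = twistedLSeries f χ.2 s) ∧ L 1 = 0} → χ.1 ≤ B :=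
    fun χ hχ ↦ (hB₀ ⟨χ, hχ, rfl⟩).trans (le_max_left _ _)
  -- the exceptional set: `ζ - 1` for `ζ^{2^B} = 1`
  refine ⟨(Polynomial.nthRootsFinset (2 ^ B) (1 : ℂ_[2])).image (fun ζ ↦ ζ - 1), ?_⟩
  intro m hm χ hχp hχe hχS
  -- `m > B` (a character mod `2^m`, `m ≤ B`, has `χ(γ₀)^{2^B} = 1`)
  have hmB : B < m := by
    by_contra hle
    rw [not_lt] at hle
    apply hχS
    rw [Finset.mem_image]
    refine ⟨χ (cyclotomicGenerator 2 : ZMod (2 ^ m)), ?_, rfl⟩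
    rw [Polynomial.mem_nthRootsFinset (pow_pos two_pos B)]
    haveI : NeZero (2 ^ m) := ⟨pow_ne_zero _ two_ne_zero⟩
    have hcop : Nat.Coprime (cyclotomicGenerator 2) (2 ^ m) := by
      rw [cyclotomicGenerator_two]; exact Nat.Coprime.pow_right _ (by norm_num)
    have hu := ZMod.pow_totient (ZMod.unitOfCoprime _ hcop)
    rw [Nat.totient_prime_pow Nat.prime_two hm] at hu
    have hdvd : 2 ^ (m - 1) * (2 - 1) ∣ 2 ^ B := by
      rw [show (2 - 1 : ℕ) = 1 from rfl, mul_one]; exact pow_dvd_pow 2 (by omega)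
    obtain ⟨q, hq⟩ := hdvd
    rw [← ZMod.coe_unitOfCoprime _ hcop, ← map_pow, ← Units.val_pow_eq_pow_val, hq, pow_mul, hu, one_pow,
      Units.val_one, map_one]
  obtain ⟨n, rfl⟩ : ∃ n, m = n + 2 := ⟨m - 2, by omega⟩
  have hBn : B < 2 ^ (n + 2) := lt_of_lt_of_le hmB (Nat.lt_pow_self one_lt_two).le
  have hM : cycLevel 2 (n + 2) ∅ = 2 ^ (n + 2) := by simp [cycLevel]
  have hdvd : 2 ^ (n + 2) ∣ cycLevel 2 (n + 2) ∅ := ⟨1, by rw [hM, mul_one]⟩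
  -- transport `χ` to the level `cycLevel 2 (n+2) ∅` of the witness
  set χ' : DirichletCharacter ℂ_[2] (cycLevel 2 (n + 2) ∅) := DirichletCharacter.changeLevel hdvd χ with hχ'
  have hcast : ∀ b : (ZMod (cycLevel 2 (n + 2) ∅))ˣ,
      χ' (b : ZMod (cycLevel 2 (n + 2) ∅)) = χ (ZMod.castHom hdvd (ZMod (2 ^ (n + 2))) (b : ZMod _)) := by
    intro b
    rw [hχ', DirichletCharacter.changeLevel_eq_cast_of_dvd χ hdvd b, ZMod.castHom_apply]
  have hχ'e : χ'.Even := by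
    change χ' (-1) = 1
    rw [← Units.coe_neg_one, hcast, Units.coe_neg_one, map_neg, map_one]
    exact hχe
  have hχp' : χ.conductor = 2 ^ (n + 2) := hχp
  have hχ'p : χ'.IsPrimitive := by
    rw [DirichletCharacter.isPrimitive_def, hχ', DirichletCharacter.conductor_changeLevel χ hdvd, hχp', hM]
  -- `g = 5` and `u = χ_cyc(γ)` at level `M`
  obtain ⟨g, hg⟩ := LayerCharacterTwo.exists_unit_eq_five (n := n) hM
  have hχ'g : χ' (g : ZMod (cycLevel 2 (n + 2) ∅)) = χ (cyclotomicGenerator 2 : ZMod (2 ^ (n + 2))) := by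
    rw [hcast, hg, cyclotomicGenerator_two]
    rw [show (5 : ZMod (cycLevel 2 (n + 2) ∅)) = ((5 : ℕ) : ZMod (cycLevel 2 (n + 2) ∅)) by norm_cast,
      map_natCast]
  have hgenu := hK.exists_eq_pow_or_eq_neg_pow_of_isTopGenerator_two hγ n hM
  obtain ⟨t, ht⟩ := hgenu g
  obtain ⟨t', -, ht'⟩ := LayerCharacterTwo.exists_eq_five_pow_or_eq_neg_five_pow hM hg
    (modNCyclotomicCharacter ℚ (cycLevel 2 (n + 2) ∅) γ)
  -- values at `g` and `u = χ_cyc(γ)`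
  have hval_g : χ' (g : ZMod (cycLevel 2 (n + 2) ∅)) =
      χ' ((modNCyclotomicCharacter ℚ (cycLevel 2 (n + 2) ∅) γ : (ZMod (cycLevel 2 (n + 2) ∅))ˣ) :
        ZMod (cycLevel 2 (n + 2) ∅)) ^ t := by
    have : χ' ((modNCyclotomicCharacter ℚ (cycLevel 2 (n + 2) ∅) γ ^ t : (ZMod (cycLevel 2 (n + 2) ∅))ˣ) :
        ZMod _) = χ' ((modNCyclotomicCharacter ℚ (cycLevel 2 (n + 2) ∅) γ : (ZMod (cycLevel 2 (n + 2) ∅))ˣ) :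
        ZMod _) ^ t := by
      rw [Units.val_pow_eq_pow_val, map_pow]
    rcases ht with h | h
    · rw [h]; exact this
    · rw [h, Units.val_neg, hχ'e.eval_neg]; exact this
  have hval_u : χ' ((modNCyclotomicCharacter ℚ (cycLevel 2 (n + 2) ∅) γ : (ZMod (cycLevel 2 (n + 2) ∅))ˣ) :
        ZMod (cycLevel 2 (n + 2) ∅)) = χ' (g : ZMod (cycLevel 2 (n + 2) ∅)) ^ t' := by
    have : χ' ((g ^ t' : (ZMod (cycLevel 2 (n + 2) ∅))ˣ) : ZMod _) = χ' (g : ZMod _) ^ t' := by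
      rw [Units.val_pow_eq_pow_val, map_pow]
    rcases ht' with h | h
    · rw [h]; exact this
    · rw [h, Units.val_neg, hχ'e.eval_neg]; exact this
  -- the finite order of `χ'`
  have hfin : ∃ o : ℕ, 0 < o ∧ χ' ^ o = 1 := by
    refine ⟨Fintype.card (ZMod (cycLevel 2 (n + 2) ∅))ˣ, Fintype.card_pos, MulChar.ext fun b ↦ ?_⟩
    rw [MulChar.pow_apply_coe, MulChar.one_apply_coe, ← map_pow, ← Units.val_pow_eq_pow_val, pow_card_eq_one,
      Units.val_one, map_one]
  obtain ⟨o, ho, hχo⟩ := hfin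
  have hgo : χ' (g : ZMod (cycLevel 2 (n + 2) ∅)) ^ o = 1 := by
    rw [← MulChar.pow_apply_coe, hχo, MulChar.one_apply_coe]
  -- `ψ := (χ'^t)⁻¹`
  set ψ : DirichletCharacter ℂ_[2] (cycLevel 2 (n + 2) ∅) := (χ' ^ t)⁻¹ with hψ
  have hψe : ψ.Even := even_inv (LayerCharacterTwo.even_pow hχ'e t)
  have hψu : ψ ((modNCyclotomicCharacter ℚ (cycLevel 2 (n + 2) ∅) γ : (ZMod (cycLevel 2 (n + 2) ∅))ˣ) :
      ZMod (cycLevel 2 (n + 2) ∅)) = (χ (cyclotomicGenerator 2 : ZMod (2 ^ (n + 2))))⁻¹ := by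
    rw [hψ, MulChar.inv_apply_eq_inv', MulChar.pow_apply_coe, ← hval_g, hχ'g]
  -- `ψ` is primitive: `ψ = χ'^{t(o-1)}` and `χ' = ψ^{t'(o-1)}`
  have hb : χ' ^ (t * (o - 1)) = ψ := by
    rw [hψ]
    refine eq_inv_of_mul_eq_one_left ?_
    rw [← pow_add, show t * (o - 1) + t = t * o by
        rw [Nat.mul_sub_one, Nat.sub_add_cancel (Nat.le_mul_of_pos_right t ho)],
      pow_mul', hχo, one_pow]
  have hug : χ (cyclotomicGenerator 2 : ZMod (2 ^ (n + 2))) ≠ 0 := by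
    rw [← hχ'g, ← MulChar.coe_toUnitHom]; exact (χ'.toUnitHom g).ne_zero
  have ha' : ψ ^ (t' * (o - 1)) = χ' := by
    refine eq_of_even_of_apply_eq_of_forall_eq_pow_or hgenu (LayerCharacterTwo.even_pow hψe _) hχ'e ?_
    rw [MulChar.pow_apply_coe, hψu, hval_u, hχ'g, inv_pow]
    -- `(χ(γ₀)^{t'(o-1)})⁻¹ = χ(γ₀)^{t'}` since `χ(γ₀)^{t' o} = 1`
    have h1 : χ (cyclotomicGenerator 2 : ZMod (2 ^ (n + 2))) ^ (t' * (o - 1)) *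
        χ (cyclotomicGenerator 2 : ZMod (2 ^ (n + 2))) ^ t' = 1 := by
      rw [← pow_add, show t' * (o - 1) + t' = t' * o by
        rw [Nat.mul_sub_one, Nat.sub_add_cancel (Nat.le_mul_of_pos_right t' ho)], pow_mul', ← hχ'g, hgo, one_pow]
    exact inv_eq_of_mul_eq_one_right h1
  have hψp : ψ.IsPrimitive := LayerCharacterTwo.isPrimitive_of_pow_eq_of_pow_eq hχ'p ha' hb
  -- a `2`-adic embedding of `ℚ(ζ_M)` and the functional
  haveI : Module.IsTorsionFree ℚ (CyclotomicField (cycLevel 2 (n + 2) ∅) ℚ) :=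
    DivisionSemiring.to_moduleIsTorsionFree
  haveI : Module.IsTorsionFree ℚ ℂ_[2] := DivisionSemiring.to_moduleIsTorsionFree
  let ι₂ : CyclotomicField (cycLevel 2 (n + 2) ∅) ℚ →+* ℂ_[2] :=
    (IsAlgClosed.lift (R := ℚ) (M := ℂ_[2]) (S := CyclotomicField (cycLevel 2 (n + 2) ∅) ℚ)).toRingHom
  have hle : cycSubgroup 2 (n + 2) ∅ ≤ K.layerSubgroup n :=
    hK.cyclotomicLevelsRat_level_le_layerSubgroup_two (badPlaces c d A N) n
  letI : Fintype (K.layerSubgroup n ⧸ (cycSubgroup 2 (n + 2) ∅).subgroupOf (K.layerSubgroup n)) :=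
    Fintype.ofFinite _
  obtain ⟨w, hw1, hw2, hw3⟩ := exists_layerEigenfunctional (W := W) (p := 2) (U := K.layerSubgroup n) (n + 2)
    hle (Λ' (n + 2) ∅) (hbody.2.2.1 (n + 2) ∅) ι₂ ψ
  refine ⟨n, w, ?_, hw1, fun v ↦ ?_, ?_⟩
  · -- `χ(γ₀)^{2^n} = 1` (`5` has order `2^n` mod `2^{n+2}`)
    rw [cyclotomicGenerator_two, ← map_pow,
      show ((5 : ℕ) : ZMod (2 ^ (n + 2))) ^ 2 ^ n = 1 by
        rw [Nat.cast_ofNat, ← ZMod.orderOf_five n, pow_orderOf_eq_one], map_one]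
  · -- eigenvalue `ψ(u)⁻¹ = χ(γ₀)`
    rw [hw2 γ v, hψu, inv_inv]
  · -- the value at `proj_n y`
    have hχU : ∀ σ ∈ K.layerSubgroup n,
        ψ ((modNCyclotomicCharacter ℚ (cycLevel 2 (n + 2) ∅) σ : (ZMod (cycLevel 2 (n + 2) ∅))ˣ) :
          ZMod (cycLevel 2 (n + 2) ∅)) = 1 :=
      fun σ hσ ↦ hK.dirichletCharacter_apply_eq_one_of_mem_layerSubgroup_two n hM ψ hψe hσ
    have hval := hw3 (z (n + 2) (cyclotomicLevelsRat 2 (badPlaces c d A N)).idealOne)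
      (x (n + 2) (cyclotomicLevelsRat 2 (badPlaces c d A N)).idealOne)
      (hbody.2.2.2.2.1 (n + 2) (cyclotomicLevelsRat 2 (badPlaces c d A N)).idealOne) hχU
    have hproj : w (I.proj n y) =
        (Fintype.card (K.layerSubgroup n ⧸ (cycSubgroup 2 (n + 2) ∅).subgroupOf (K.layerSubgroup n)) : ℂ_[2]) *
          ∑ b : (ZMod (cycLevel 2 (n + 2) ∅))ˣ, ψ (b : ZMod (cycLevel 2 (n + 2) ∅)) *
            ι₂ (sigma (cycLevel 2 (n + 2) ∅) b (x (n + 2) (cyclotomicLevelsRat 2 (badPlaces c d A N)).idealOne)) := by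
      rw [hy n]
      unfold levelToLayerTwo
      exact hval
    rw [hproj]
    refine mul_ne_zero ?_ ?_
    · exact_mod_cast Fintype.card_ne_zero
    · exact sum_character_embed_sigma_ne_zero_of_rohrlich_two hbody hf hκ' hA hc hd hcA hdA hc1 hd1 ha hB n hBn
        ι₂ ψ hψe hψp

end Assembly

end Literature.NumberTheory.EllipticCurves.Kato2004

end
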